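import Mathlib
import HarnessLib

/-!
# `MagicFunctionsPersist`, line `Sketch`: stub `stub_params` (item stmt-PneNP-2328)

Parameter arithmetic of the first-moment (union-bound) argument over `q`-ary lattices in
dimension `n = 2m` with modulus `q ≥ n` and radius `r`, `r² = 5 q √n`:
* `r ≤ q` (short nonzero integer vectors stay nonzero mod `q`);
* `4 q √n < r²` (the transference target);
* `2 · (1 + √n/r)ⁿ · (π e r²/m)^m < q^m` (the expected number of short vectors is `< 1/2`).
All three hold with a large margin once `m ≥ 2^18`; we use only crude rational bounds
(`π e ≤ 9`, `√n ≥ 724`, `√n / r ≤ 1/10`).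
-/

set_option linter.dupNamespace false

namespace Summit.PneNP.PneNP.Theorems.LatticeMagicMagicFunctionsPersist

/-- Parameter arithmetic for the first-moment argument: if `m ≥ 2^18`, `n = 2m`, `q ≥ n`,
`r > 0` and `r² = 5 q √n`, then `r ≤ q`, `4 q √n < r²`, and
`2 · ((1 + √n/r)ⁿ · (π e r²/m)^m) < q^m`. -/
theorem stub_params {m : ℕ} (hm : 2 ^ 18 ≤ m) {n : ℕ} (hn : n = 2 * m) {q : ℝ} (hq : (n : ℝ) ≤ q)
    {r : ℝ} (hr0 : 0 < r) (hr : r ^ 2 = 5 * q * Real.sqrt n) :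
    r ≤ q ∧ 4 * q * Real.sqrt n < r ^ 2 ∧
      2 * ((1 + Real.sqrt n / r) ^ n * (Real.pi * Real.exp 1 * r ^ 2 / m) ^ m) < q ^ m := by
  -- Basic size facts, cast to `ℝ`.
  have hm' : 262144 ≤ m := le_trans (by norm_num) hm
  have hmR : (262144 : ℝ) ≤ (m : ℝ) := by exact_mod_cast hm'
  have hnR : (n : ℝ) = 2 * (m : ℝ) := by exact_mod_cast hn
  have hn19 : (524288 : ℝ) ≤ (n : ℝ) := by rw [hnR]; linarith
  have hn0 : (0 : ℝ) ≤ (n : ℝ) := by positivity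
  -- Name `s := √n`.
  set s : ℝ := Real.sqrt (n : ℝ) with hs_def
  have hs2 : s ^ 2 = (n : ℝ) := Real.sq_sqrt hn0
  have hs724 : (724 : ℝ) ≤ s := by
    rw [hs_def, Real.le_sqrt (by norm_num) hn0]
    norm_num
    linarith
  have hs0 : (0 : ℝ) < s := by linarith
  have hsq : s ^ 2 ≤ q := hs2 ▸ hq
  have hq0 : (0 : ℝ) < q := by nlinarith
  have hss : 724 * s ≤ s ^ 2 := by nlinarith [mul_nonneg hs0.le (sub_nonneg.2 hs724)]
  -- (a) `r ≤ q`, via `r² = 5 q s ≤ q²` since `5 s ≤ s² ≤ q`.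
  have h5 : 5 * s ≤ q := by nlinarith
  have hrq2 : r ^ 2 ≤ q ^ 2 := by
    rw [hr]
    nlinarith [mul_nonneg hq0.le (sub_nonneg.2 h5)]
  have ha : r ≤ q := (pow_le_pow_iff_left₀ hr0.le hq0.le two_ne_zero).1 hrq2
  -- (b) `4 q s < 5 q s = r²`.
  have hb : 4 * q * s < r ^ 2 := by
    rw [hr]
    nlinarith [mul_pos hq0 hs0]
  refine ⟨ha, hb, ?_⟩
  -- (c) First `s / r ≤ 1/10`, from `100 s² ≤ 5 q s = r²`.
  have h20 : 100 * s ≤ 5 * q := by nlinarith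
  have h10r : 10 * s ≤ r := by
    have h' : (10 * s) ^ 2 ≤ r ^ 2 := by
      rw [hr]
      nlinarith [mul_nonneg hs0.le (sub_nonneg.2 h20)]
    exact (pow_le_pow_iff_left₀ (by positivity) hr0.le two_ne_zero).1 h'
  have hx0 : 0 ≤ s / r := div_nonneg hs0.le hr0.le
  have hx : s / r ≤ 1 / 10 := by
    rw [div_le_iff₀ hr0]
    linarith
  have h1 : (1 + s / r) ^ 2 ≤ 121 / 100 := by
    have h11 : 1 + s / r ≤ 11 / 10 := by linarith
    calc (1 + s / r) ^ 2 ≤ (11 / 10) ^ 2 := pow_le_pow_left₀ (by positivity) h11 2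
      _ = 121 / 100 := by norm_num
  -- Next `π e r² / m = 10 π e q / s ≤ q / 5`, using `π e ≤ 9` and `s ≥ 724`.
  have hpe : Real.pi * Real.exp 1 ≤ 9 := by
    nlinarith [Real.pi_lt_d2, Real.exp_one_lt_d9, Real.pi_pos, Real.exp_pos 1]
  have hpe0 : 0 ≤ Real.pi * Real.exp 1 := by positivity
  have hmR' : (m : ℝ) = s ^ 2 / 2 := by rw [hs2, hnR]; ring
  have hm0 : (0 : ℝ) < (m : ℝ) := by rw [hmR']; positivity
  have h2 : Real.pi * Real.exp 1 * r ^ 2 / m ≤ q / 5 := by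
    rw [div_le_iff₀ hm0, hr, hmR']
    have hqs : 0 ≤ q * s := by positivity
    nlinarith [mul_nonneg hqs (sub_nonneg.2 hs724), mul_nonneg hqs (sub_nonneg.2 hpe)]
  -- Hence the base `B := (1 + s/r)² · (π e r²/m)` is at most `q / 4`.
  have hB0 : 0 ≤ (1 + s / r) ^ 2 * (Real.pi * Real.exp 1 * r ^ 2 / m) := by positivity
  have hB : (1 + s / r) ^ 2 * (Real.pi * Real.exp 1 * r ^ 2 / m) ≤ q / 4 :=
    calc (1 + s / r) ^ 2 * (Real.pi * Real.exp 1 * r ^ 2 / m) ≤ 121 / 100 * (q / 5) :=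
          mul_le_mul h1 h2 (by positivity) (by norm_num)
      _ ≤ q / 4 := by linarith
  have hBm : ((1 + s / r) ^ 2 * (Real.pi * Real.exp 1 * r ^ 2 / m)) ^ m ≤ (q / 4) ^ m :=
    pow_le_pow_left₀ hB0 hB m
  -- Rewrite the left-hand side as `2 · B ^ m` using `n = 2m`.
  have hLHS : (1 + s / r) ^ n * (Real.pi * Real.exp 1 * r ^ 2 / m) ^ m
      = ((1 + s / r) ^ 2 * (Real.pi * Real.exp 1 * r ^ 2 / m)) ^ m := by
    rw [hn, pow_mul, mul_pow]
  -- Conclude: `2 · (q/4)^m = 2 q^m / 4^m ≤ q^m / 2 < q^m`.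
  have hm1 : 1 ≤ m := le_trans (by norm_num) hm
  have h4m : (4 : ℝ) ≤ 4 ^ m := by
    calc (4 : ℝ) = 4 ^ 1 := by norm_num
      _ ≤ 4 ^ m := pow_le_pow_right₀ (by norm_num) hm1
  have hqm : 0 < q ^ m := pow_pos hq0 m
  have hdiv : q ^ m / 4 ^ m ≤ q ^ m / 4 := div_le_div_of_nonneg_left hqm.le (by norm_num) h4m
  rw [hLHS]
  calc 2 * ((1 + s / r) ^ 2 * (Real.pi * Real.exp 1 * r ^ 2 / m)) ^ m
      ≤ 2 * (q / 4) ^ m := by linarith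
    _ = 2 * (q ^ m / 4 ^ m) := by rw [div_pow]
    _ < q ^ m := by linarith

end Summit.PneNP.PneNP.Theorems.LatticeMagicMagicFunctionsPersist
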